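import Literature.NumberTheory.EllipticCurves.Kato2004.ZetaClassOnRankLeOneBranch
import HarnessLib

/-!
# Kato 2004 (Astérisque 295), Thm. 12.5 (1) with §13.9 «independent of the choices» — in the tree's currency the uniform
# position predicate `ZetaClassPosition` pins `z₁` only UP TO `Λˣ`: its witness set is a union of `Λˣ`-orbits

Topic `NumberTheory/EllipticCurves`, sub-directory `Kato2004` (namespace = path).  Cell `bsd-cm`, seat `bsd-cm-k-ty1` g33
(literature-prover) on the planner's word D1108 (R8) / D1109 («the orbit lemma is worth landing under `Kato2004/`, kernel
lane»); statement and proof are the critic's (idea-crit-15 g17, NOTE #13 (1) / NOTE #14, probe `probes/SD/W_orbit.lean`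
6293ec12bc98c229, farm rc 0, standard axioms) — landed here token-compatibly.  THEOREMS ONLY (pure `Λ`-module algebra on the
tree's predicates of `Kato2004/ZetaClassOnRankLeOneBranch.lean`); no `def`, no instance, no notation, no named fact, no `sorry`.

## What it says, and why it matters

`ZetaClassPositionBody W p K hK I k z₁` («`z₁ = p^k · 𝐳_{γ_W}` uniformly with respect to every realised value-pinned
family», §2 of the branch file) concludes, for every realised family `y`, `z₁ ≠ 0 ∧ ∃ u : Λˣ, (p^{(−e)⁺}·M̃) • z₁ =
(u·p^{e⁺}·p^k) • y`.  Because the unit `u` is EXISTENTIALLY bound, the predicate is STABLE UNDER `Λˣ`: if `z₁` is in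
position then so is `v • z₁` for every `v : Λˣ` (take `v·u`).  Hence a class CHOSEN from `∃ z₁ k, ZetaClassPosition … k z₁`
(`Classical.choice`, e.g. the pinned frame's `zOne`) is determined at best up to `Λˣ`, and any statement about such a chosen
witness that is not itself `Λˣ`-invariant (e.g. an exact value law with unit `uStar := 1`) is underivable — the planner's
D1108 (R1′) «witness-invariance» rule.  Kato's own `z_γ^{(p)}` IS independent of the choices (§13.9, p. 230 l. 8–9); the
ambiguity is the tree predicate's `∃ u`, by design (Lemma 13.10 (1) positions `z_γ^{(p)}` against a family through a unit).

## Statements (all proved)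

* `ZetaClassPositionBody.units_smul (h : ZetaClassPositionBody W p K hK I k z₁) (v : Λˣ) : ZetaClassPositionBody … k (v • z₁)`;
* `ZetaClassPosition.units_smul` — the same for the CLOSED predicate (through `zetaClassPosition_iff`);
* `exists_zetaClassPosition_units_smul` — the `∃ z₁ k`-package is carried along `v • ·`.

## References

* [Kato2004Asterisque] K. Kato, Astérisque 295 (2004), Thm. 12.5 (1)(2) (p. 221), §13.9 (p. 230, l. 8–9 «independent of
  the choices»), Lemma 13.10 (1) (p. 230).
* Tree: `Kato2004/ZetaClassOnRankLeOneBranch.lean` (`ZetaClassPositionBody`, `ZetaClassPosition`, `zetaClassPosition_iff`).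
-/

noncomputable section

open scoped NumberField TensorProduct
open Field IsDedekindDomain NumberField
open Literature.NumberTheory.GaloisRepresentations
open Literature.NumberTheory.EllipticCurves

namespace Literature.NumberTheory.EllipticCurves.Kato2004

section Orbit

variable {W : WeierstrassCurve ℚ} [W.IsElliptic] [W.IsGloballyMinimal] {p : ℕ} [Fact p.Prime]
  [ContinuousSMul ℤ_[p] (W.tateModule p)] {K : ZpExtension ℚ p} {hK : K.IsCyclotomic}
  {γ : absoluteGaloisGroup ℚ} {I : IwasawaH1Data W p K γ}

/-- **The uniform position is stable under `Λˣ`** (open form, ANY instances of the two structure facts): if `z₁` is in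
position with exponent `k`, so is `v • z₁` for every unit `v` of `Λ = IwasawaAlgebra p` — non-vanishing transports through
`v⁻¹`, and the position unit becomes `v·u`.  Pure algebra (the critic's orbit lemma, NOTE #14). Kernel.
[cite: Kato2004Asterisque, Thm. 12.5 (1) (p. 221), §13.9 (p. 230, "independent of the choices"), Lemma 13.10 (1) (p. 230)] -/
theorem ZetaClassPositionBody.units_smul [Module.Free ℤ_[p] (W.tateModule p)] [Module.Finite ℤ_[p] (W.tateModule p)]
    {k : ℕ} {z₁ : I.H} (h : ZetaClassPositionBody W p K hK I k z₁) (v : (IwasawaAlgebra p)ˣ) :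
    ZetaClassPositionBody W p K hK I k (v • z₁) := by
  intro hp N hN f hf ι q Λ hq hZ c d₁ a A d' hA hc hd hdd' hRm z x hzeta y hy qm perRatio e n₁ n₂ n₃ n₄ σc σd σℓ hqm
    hspan h₁ h₂ h₃ h₄ hσc hσd hσℓ hper0 hper he
  obtain ⟨hne, u, hu⟩ := h hp N hN f hf ι q Λ hq hZ c d₁ a A d' hA hc hd hdd' hRm z x hzeta y hy qm perRatio e n₁ n₂
    n₃ n₄ σc σd σℓ hqm hspan h₁ h₂ h₃ h₄ hσc hσd hσℓ hper0 hper he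
  refine ⟨fun h0 => hne ?_, v * u, ?_⟩
  · rw [← inv_smul_smul v z₁, h0, smul_zero]
  · rw [Units.smul_def, smul_smul, mul_comm, mul_smul, hu, smul_smul, Units.val_mul]
    congr 1
    ring

/-- **The uniform position is stable under `Λˣ`** (CLOSED predicate `ZetaClassPosition`, the structure facts supplied by the
tree theorems). Kernel. [cite: Kato2004Asterisque, Thm. 12.5 (1) (p. 221), §13.9 (p. 230, "independent of the choices")] -/
theorem ZetaClassPosition.units_smul {k : ℕ} {z₁ : I.H} (h : ZetaClassPosition W p K hK I k z₁)
    (v : (IwasawaAlgebra p)ˣ) : ZetaClassPosition W p K hK I k (v • z₁) := by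
  haveI : Module.Free ℤ_[p] (W.tateModule p) := W.module_free_tateModule_holds p
  haveI : Module.Finite ℤ_[p] (W.tateModule p) := W.module_finite_tateModule_holds p
  exact (zetaClassPosition_iff k (v • z₁)).mpr (((zetaClassPosition_iff k z₁).mp h).units_smul v)

/-- **The `∃`-package of the position is a union of `Λˣ`-orbits**: from `∃ z₁ k, ZetaClassPosition … k z₁` one gets, for
every unit `v`, a witness of the form `v • z₁` — so a witness CHOSEN from the package is pinned at best up to `Λˣ`
(planner D1108 (R1′): statements about a chosen witness must be `Λˣ`-invariant). Kernel.
[cite: Kato2004Asterisque, Thm. 12.5 (1) (p. 221), §13.9 (p. 230, "independent of the choices")] -/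
theorem exists_zetaClassPosition_units_smul (h : ∃ (z₁ : I.H) (k : ℕ), ZetaClassPosition W p K hK I k z₁)
    (v : (IwasawaAlgebra p)ˣ) : ∃ (z₁ : I.H) (k : ℕ), ZetaClassPosition W p K hK I k z₁ ∧
      ZetaClassPosition W p K hK I k (v • z₁) := by
  obtain ⟨z₁, k, hz⟩ := h
  exact ⟨z₁, k, hz, hz.units_smul v⟩

end Orbit

end Literature.NumberTheory.EllipticCurves.Kato2004

end
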